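import Literature.AlgebraicGeometry.Motives.VerticalLimitsOfLines
import Literature.AlgebraicGeometry.Motives.RationalPointsOnLinearSubspace
import Literature.AlgebraicGeometry.Motives.ClosedSubvarietyOfPoint
import HarnessLib

/-!
# The ruled-surface relation: two points of a line of the generic fibre differ by vertical lines

Let `k` be algebraically closed, `B` an integral `k`-scheme locally of finite type of dimension one
all of whose closed points have principal local rings (a smooth curve), `K = k(B)`, and
`ι : ℙᴺ_K → ℙᴺ ×ₖ B` the generic fibre of `pr₂`. For a line `L = V₊(μ₁, …, μ_{N-1}) ⊆ ℙᴺ_K` and two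
closed points `u, v ∈ L` of the same degree over `K` (e.g. two `K`-points), this file proves the
cycle-level **ruled-surface relation** (`exists_relation_of_two_points_on_line`): there is a
generator `c'` of `Rat₁(ℙᴺ ×ₖ B)` (namely `[div_S ḡ]`, `S` the closure of `ι(L)`, a surface ruled
over `B`) with `c' = [ι u] - [ι v] + vert`, where every point `z` with `vert z ≠ 0` is a point of
dimension `1` lying over a CLOSED point of `B` whose projection `pr₁ z` is (the generic point of) a
line of `ℙᴺ_k`. This is "two sections of a ruled surface are rationally equivalent modulo rational
curves in the fiber" (Tian–Zong 2014, proofs of Prop. 3.1 and Prop. 7.2; Kollár, *Rational curves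
on algebraic varieties*, IV.3.13) for the family of lines `S → B`, in the tree's form: the relation
`[u] - [v] = [div g]` on `L` (`Motives/RationalPointsOnLinearSubspace`) is spread to `ℙᴺ ×ₖ B` by
Bloch's Lemma 1A.1 (`Motives/GenericFibreRatSpread`: `[div_S ḡ] ∘ ι = [div_L g]`), and the
remaining (vertical) components are lines by `Motives/VerticalLimitsOfLines`.

Also here: the generic fibre `genericFibreι` (`pullback.lift` of `ℙᴺ_K → ℙᴺ_k` and
`ℙᴺ_K → Spec K → B`) and its cartesian square over `Spec K → B` (`isPullback_genericFibreι`).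
Everything is proved; no named facts.

## References

* [TianZong2014] Z. Tian, H. R. Zong, *One-cycles on rationally connected varieties*, Compositio
  Math. 150 (2014), proofs of Prop. 3.1 and Prop. 7.2.
* [BlochLectures2010] S. Bloch, *Lectures on Algebraic Cycles*, Lemma 1A.1.
* [Fulton1998] W. Fulton, *Intersection Theory*, §1.3, §10.1.
-/

noncomputable section

open CategoryTheory CategoryTheory.Limits AlgebraicGeometry MonoidalCategory MvPolynomial
  TopologicalSpace Order

universe u

namespace Literature.AlgebraicGeometry.Motives

attribute [local instance] MvPolynomial.gradedAlgebra MvPolynomial.algebraMvPolynomial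
  Literature.AlgebraicGeometry.Motives.ProjBaseChange.algebraBase
  UniversalHyperplaneSection.sectionsAlgebra ProjFamily.functionFieldAlgebra

namespace ProjFamily

open ProjBaseChangeRing ProjectiveSpaceCells

variable {k : Type u} [Field k]

/-! ### Small topological lemmas -/

/-- A point of dimension `0` of a scheme is closed. (The same statement is
`Literature.AlgebraicGeometry.Motives.isClosed_singleton_of_height_eq_zero` of
`Motives/ChowZeroSupportedOnHyperplaneSection`, whose imports — hyperplane multiplicities — are
unrelated to this file; hence this primed local copy.) [folklore] -/
theorem isClosed_singleton_of_height_eq_zero' {Y : Scheme.{u}} {x : Y} (hx : height x = 0) :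
    IsClosed ({x} : Set Y) := by
  have hcl : closure ({x} : Set Y) = {x} := by
    refine Set.Subset.antisymm (fun y hy => ?_) subset_closure
    have hxy : x ⤳ y := specializes_iff_mem_closure.mpr hy
    have hle : y ≤ x := Scheme.le_iff_specializes.2 hxy
    have hmin : IsMin x := Order.height_eq_zero.1 hx
    have hyx : y ⤳ x := Scheme.le_iff_specializes.1 (hmin hle)
    exact (hyx.antisymm hxy).eq
  rw [← hcl]
  exact isClosed_closure

/-- On an irreducible scheme whose generic point has dimension `1`, every other point is closed.
[folklore] -/
theorem isClosed_singleton_of_ne_genericPoint {Y : Scheme.{u}} [IsIntegral Y]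
    (hY : height (genericPoint Y) = 1) {y : Y} (hy : y ≠ genericPoint Y) :
    IsClosed ({y} : Set Y) := by
  apply isClosed_singleton_of_height_eq_zero'
  have hle : y ≤ genericPoint Y := Scheme.le_iff_specializes.mpr (genericPoint_specializes y)
  have hlt : y < genericPoint Y := lt_of_le_not_ge hle fun hge =>
    hy ((Scheme.le_iff_specializes.mp hge).antisymm (genericPoint_specializes y)).eq
  have hfin : height y < ⊤ :=
    (height_mono hle).trans_lt (by rw [hY]; exact ENat.coe_lt_top 1)
  have h := height_strictMono hlt hfin
  rw [hY] at h
  exact Order.lt_one_iff.mp h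

/-! ### The generic point of `B` and the generic fibre of `ℙᴺ ×ₖ B → B` -/

section GenericFibre

variable (N : ℕ) (B : SchemeOver k) [IsIntegral B.left]

/-- The generic point `Spec k(B) → B` (Mathlib `Scheme.fromSpecStalk` at the generic point).
[folklore] -/
abbrev qgen : Spec B.left.functionField ⟶ B.left := B.left.fromSpecStalk (genericPoint B.left)

/-- The image of the generic point morphism is `{η}`. [folklore] -/
theorem range_qgen : Set.range (qgen B).base = {genericPoint B.left} := by
  change Set.range (B.left.fromSpecStalk (genericPoint B.left)).base = _
  rw [Scheme.range_fromSpecStalk]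
  ext y
  simp only [Set.mem_setOf_eq, Set.mem_singleton_iff]
  exact ⟨fun h => (h.antisymm (genericPoint_specializes y)).eq, fun h => h ▸ specializes_rfl⟩

/-- `Spec k(B) → B` is flat (the local ring at its image, the generic point, is a field).
[folklore] -/
instance flat_qgen : Flat (qgen B) := by
  refine Flat.of_stalkMap _ fun s => ?_
  have hs : (qgen B).base s = genericPoint B.left := by
    have : (qgen B).base s ∈ Set.range (qgen B).base := ⟨s, rfl⟩
    rw [range_qgen] at this
    exact this
  have hfield : IsField (B.left.presheaf.stalk ((qgen B).base s)) := by
    rw [hs]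
    exact Field.toIsField B.left.functionField
  exact RingHom.Flat.of_isField hfield _

/-- `Spec k(B) → B` is quasi-compact (its source is a point). [folklore] -/
instance quasiCompact_qgen : QuasiCompact (qgen B) :=
  haveI : Finite ↥(Spec B.left.functionField) :=
    inferInstanceAs (Finite (PrimeSpectrum B.left.functionField))
  ⟨fun _ _ _ ↦ (Set.toFinite _).isCompact⟩

/-- `Spec k(B) → B → Spec k` is `Spec` of the scalars `k → k(B)`. [folklore] -/
theorem qgen_comp_hom :
    qgen B ≫ B.hom = Spec.map (CommRingCat.ofHom (algebraMap k B.left.functionField)) := by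
  obtain ⟨_, ⟨U, hU, rfl⟩, hηU, -⟩ := B.left.isBasis_affineOpens.exists_subset_of_mem_open
    (Set.mem_univ (genericPoint B.left)) isOpen_univ
  haveI : Nonempty U := ⟨⟨genericPoint B.left, hηU⟩⟩
  haveI := isScalarTower_sections_functionField B U
  change B.left.fromSpecStalk (genericPoint B.left) ≫ B.hom = _
  rw [fromSpecStalk_genericPoint_eq B hU, Category.assoc, UniversalHyperplaneSection.fromSpec_comp_hom,
    ← Spec.map_comp, ← CommRingCat.ofHom_comp, ← UniversalHyperplaneSection.algebraMap_sections,
    ← IsScalarTower.algebraMap_eq k Γ(B.left, U) B.left.functionField]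

/-- **The generic fibre `ℙᴺ_K → ℙᴺ ×ₖ B`** (`K = k(B)`): the morphism with components
`ℙᴺ_K → ℙᴺ_k` (scalar extension) and `ℙᴺ_K → Spec K → B` (generic point). [folklore] -/
def genericFibreι : (projectiveSpace N B.left.functionField).left ⟶ ((projectiveSpace N k) ⊗ B).left :=
  pullback.lift (Proj.map (mapGraded k B.left.functionField (Fin (N + 1)))
      (irrelevant_le_map k B.left.functionField (Fin (N + 1))))
    (projToSpec (Fin (N + 1)) B.left.functionField ≫ qgen B) (by
      rw [Category.assoc, qgen_comp_hom]
      exact (isPullback_projMap' k B.left.functionField (n := N)).w)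

/-- `genericFibreι ≫ pr₁ = (ℙᴺ_K → ℙᴺ_k)`. [folklore] -/
theorem genericFibreι_fst :
    genericFibreι N B ≫ (CartesianMonoidalCategory.fst (projectiveSpace N k) B).left =
      Proj.map (mapGraded k B.left.functionField (Fin (N + 1)))
        (irrelevant_le_map k B.left.functionField (Fin (N + 1))) :=
  pullback.lift_fst _ _ _

/-- `genericFibreι ≫ pr₂ = (ℙᴺ_K → Spec K → B)`. [folklore] -/
theorem genericFibreι_snd :
    genericFibreι N B ≫ (CartesianMonoidalCategory.snd (projectiveSpace N k) B).left =
      projToSpec (Fin (N + 1)) B.left.functionField ≫ qgen B :=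
  pullback.lift_snd _ _ _

/-- **The generic fibre is cartesian over the generic point**: the square `genericFibreι`,
`ℙᴺ_K → Spec K`, `pr₂`, `Spec K → B` is a pullback (paste `ℙᴺ_K = ℙᴺ_k ×_k Spec K` with
`ℙᴺ ×ₖ B = ℙᴺ_k ×_k B`). [folklore] -/
theorem isPullback_genericFibreι :
    IsPullback (genericFibreι N B) (projToSpec (Fin (N + 1)) B.left.functionField)
      (CartesianMonoidalCategory.snd (projectiveSpace N k) B).left (qgen B) := by
  have hbig := isPullback_projMap' k B.left.functionField (n := N)
  rw [← qgen_comp_hom B] at hbig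
  have hprod : IsPullback (CartesianMonoidalCategory.fst (projectiveSpace N k) B).left
      (CartesianMonoidalCategory.snd (projectiveSpace N k) B).left (projectiveSpace N k).hom B.hom :=
    IsPullback.of_hasPullback (projectiveSpace N k).hom B.hom
  refine IsPullback.of_right ?_ (genericFibreι_snd N B) hprod
  rw [genericFibreι_fst]
  exact hbig

/-- The generic fibre covers exactly `pr₂⁻¹(η)`. [folklore] -/
theorem range_genericFibreι :
    Set.range (genericFibreι N B).base =
      (CartesianMonoidalCategory.snd (projectiveSpace N k) B).left.base ⁻¹' {genericPoint B.left} := by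
  rw [Literature.AlgebraicGeometry.Limits.range_fst_of_isPullback (isPullback_genericFibreι N B),
    range_qgen]

/-- The generic fibre is a preimmersion (base change of one), hence injective on points. [folklore] -/
instance isPreimmersion_genericFibreι : IsPreimmersion (genericFibreι N B) :=
  MorphismProperty.of_isPullback (isPullback_genericFibreι N B).flip inferInstance

/-- The generic fibre is quasi-compact (base change of `Spec K → B`). [folklore] -/
instance quasiCompact_genericFibreι : QuasiCompact (genericFibreι N B) :=
  MorphismProperty.of_isPullback (isPullback_genericFibreι N B).flip inferInstance

end GenericFibre

/-! ### The generic fibre of `X ×ₖ B → B` for a closed subscheme `X ⊆ ℙᴺ` -/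

section Subscheme

variable (N : ℕ) (B : SchemeOver k) [IsIntegral B.left] (X : SchemeOver k)
  (i : X ⟶ projectiveSpace N k)

/-- The generic fibre `X_K = pr₂⁻¹(η)` of `X ×ₖ B → B`, as the fibre product with `Spec K → B`.
[folklore] -/
abbrev XK : Scheme.{u} := pullback (CartesianMonoidalCategory.snd X B).left (qgen B)

/-- `X_K → X ×ₖ B`. [folklore] -/
abbrev ιX : XK B X ⟶ (X ⊗ B).left := pullback.fst (CartesianMonoidalCategory.snd X B).left (qgen B)

/-- `X_K → Spec K`. [folklore] -/
abbrev pX : XK B X ⟶ Spec B.left.functionField :=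
  pullback.snd (CartesianMonoidalCategory.snd X B).left (qgen B)

/-- The defining cartesian square of the generic fibre `X_K`. [folklore] -/
theorem isPullback_ιX :
    IsPullback (ιX B X) (pX B X) (CartesianMonoidalCategory.snd X B).left (qgen B) :=
  IsPullback.of_hasPullback _ _

omit [IsIntegral B.left] in
/-- `(i × B) ≫ pr₂ = pr₂` on underlying schemes. [folklore] -/
theorem whiskerRight_left_snd :
    (i ▷ B).left ≫ (CartesianMonoidalCategory.snd (projectiveSpace N k) B).left =
      (CartesianMonoidalCategory.snd X B).left := by
  rw [← Over.comp_left, CartesianMonoidalCategory.whiskerRight_snd]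

omit [IsIntegral B.left] in
/-- `(i × B) ≫ pr₁ = pr₁ ≫ i` on underlying schemes. [folklore] -/
theorem whiskerRight_left_fst :
    (i ▷ B).left ≫ (CartesianMonoidalCategory.fst (projectiveSpace N k) B).left =
      (CartesianMonoidalCategory.fst X B).left ≫ i.left := by
  rw [← Over.comp_left, CartesianMonoidalCategory.whiskerRight_fst, Over.comp_left]

/-- **`X_K → ℙᴺ_K`**, the generic fibre of `i × B`: the lift of `X_K → X ×ₖ B → ℙᴺ ×ₖ B` through the
cartesian square of `genericFibreι`. [folklore] -/
def iK : XK B X ⟶ (projectiveSpace N B.left.functionField).left :=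
  (isPullback_genericFibreι N B).lift (ιX B X ≫ (i ▷ B).left) (pX B X) (by
    rw [Category.assoc, whiskerRight_left_snd]
    exact (isPullback_ιX B X).w)

/-- `iK ≫ genericFibreι = ιX ≫ (i × B)`. [folklore] -/
theorem iK_genericFibreι : iK N B X i ≫ genericFibreι N B = ιX B X ≫ (i ▷ B).left :=
  (isPullback_genericFibreι N B).lift_fst _ _ _

/-- `iK ≫ (ℙᴺ_K → Spec K) = (X_K → Spec K)`. [folklore] -/
theorem iK_projToSpec : iK N B X i ≫ projToSpec (Fin (N + 1)) B.left.functionField = pX B X :=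
  (isPullback_genericFibreι N B).lift_snd _ _ _

/-- **`X_K = ℙᴺ_K ×_{ℙᴺ × B} (X × B)`**: the square `iK, ιX, genericFibreι, i × B` is cartesian
(paste the two generic-fibre squares over `Spec K → B`). [folklore] -/
theorem isPullback_iK : IsPullback (iK N B X i) (ιX B X) (genericFibreι N B) (i ▷ B).left := by
  refine IsPullback.of_right ?_ (iK_genericFibreι N B X i) (isPullback_genericFibreι N B).flip
  rw [iK_projToSpec, whiskerRight_left_snd]
  exact (isPullback_ιX B X).flip

omit [IsIntegral B.left] in
/-- `i × B` is a closed immersion when `i` is (Mathlib `MorphismProperty.pullbackMap`; cf.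
`Motives/AbelianVarietyQuotientPoints.whiskerRight_left_mem`). [folklore] -/
instance isClosedImmersion_whiskerRight_left [IsClosedImmersion i.left] :
    IsClosedImmersion (i ▷ B).left := by
  rw [Over.whiskerRight_left]
  exact MorphismProperty.pullbackMap (P := @IsClosedImmersion) ‹IsClosedImmersion i.left›
    (MorphismProperty.id_mem _ _) (Over.w i).symm (Category.id_comp _).symm

/-- `X_K → ℙᴺ_K` is a closed immersion (base change of `i × B`). [folklore] -/
instance isClosedImmersion_iK [IsClosedImmersion i.left] : IsClosedImmersion (iK N B X i) :=
  MorphismProperty.of_isPullback (isPullback_iK N B X i).flip inferInstance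

/-- The generic fibre `X_K → X × B` covers exactly `pr₂⁻¹(η)`. [folklore] -/
theorem range_ιX : Set.range (ιX B X).base =
    (CartesianMonoidalCategory.snd X B).left.base ⁻¹' {genericPoint B.left} := by
  rw [Literature.AlgebraicGeometry.Limits.range_fst_of_isPullback (isPullback_ιX B X), range_qgen]

end Subscheme

/-! ### The ruled-surface relation -/

section Relation

variable [IsAlgClosed k] {N : ℕ} (B : SchemeOver k) [IsIntegral B.left] [LocallyOfFiniteType B.hom]
  (X : SchemeOver k) (i : X ⟶ projectiveSpace N k) [IsClosedImmersion i.left]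

/-- **The ruled-surface relation** (Tian–Zong: "two sections of a ruled surface are rationally
equivalent modulo … the fiber", for the closure in `X ×ₖ B` of a line of the generic fibre). Let
`k` be algebraically closed, `X ⊆ ℙᴺ_k` closed, `B` an integral `k`-scheme locally of finite type
with generic point of dimension `1` and principal local rings at its closed points, `K = k(B)`.
Let `μ₁, …, μ_{N-1}` be independent linear forms over `K` whose line `L = V₊(μ) ⊆ ℙᴺ_K` lies in
the generic fibre `X_K`, and `u, v ∈ L` closed points of `ℙᴺ_K` of the same degree over `K`. Then
there are `c' ∈ Rat₁(X ×ₖ B)`, lifts `u_X, v_X ∈ X_K` of `u, v`, and a cycle `vert` with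
`c' = [ι u_X] - [ι v_X] + vert` (`ι : X_K → X ×ₖ B`) such that every `z` with `vert z ≠ 0` has
dimension `1`, lies over a closed point of `B`, and `i (pr₁ z)` is the generic point of a line:
`closure {i (pr₁ z)} = V₊(L̄)` for `N - 1` independent linear forms `L̄` over `k`.
[cite: TianZong2014, proofs of Prop. 3.1 and Prop. 7.2] [cite: BlochLectures2010, Lemma 1A.1] -/
theorem exists_relation_of_two_points_on_line (hN : 1 ≤ N) (hB1 : height (genericPoint B.left) = 1)
    (hpid : ∀ b : B.left, IsClosed ({b} : Set B.left) →
      IsPrincipalIdealRing (B.left.presheaf.stalk b))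
    (μ : Fin (N - 1) → MvPolynomial (Fin (N + 1)) B.left.functionField)
    (hμli : LinearIndependent B.left.functionField μ) (hμhom : ∀ l, (μ l).IsHomogeneous 1)
    (hline : ProjectiveSpectrum.zeroLocus
      (homogeneousSubmodule (Fin (N + 1)) B.left.functionField) (Set.range μ) ⊆
        Set.range (iK N B X i).base)
    {u v : ↥(projectiveSpace N B.left.functionField).left}
    (hu : u ∈ ProjectiveSpectrum.zeroLocus
      (homogeneousSubmodule (Fin (N + 1)) B.left.functionField) (Set.range μ))
    (hv : v ∈ ProjectiveSpectrum.zeroLocus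
      (homogeneousSubmodule (Fin (N + 1)) B.left.functionField) (Set.range μ))
    (hu0 : height u = 0) (hv0 : height v = 0)
    (hdeg : (projectiveSpace N B.left.functionField).hom.residueDegree u =
      (projectiveSpace N B.left.functionField).hom.residueDegree v) :
    ∃ c' ∈ ratTrivial (X ⊗ B).left 1, ∃ uX vX : ↥(XK B X),
      (iK N B X i).base uX = u ∧ (iK N B X i).base vX = v ∧
      ∃ vert : AlgebraicCycle (X ⊗ B).left ℤ,
        c' = primeCycle ((ιX B X).base uX) - primeCycle ((ιX B X).base vX) + vert ∧
        ∀ z, vert z ≠ 0 → height z = 1 ∧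
          IsClosed ({(CartesianMonoidalCategory.snd X B).left.base z} : Set B.left) ∧
          ∃ L : Fin (N - 1) → MvPolynomial (Fin (N + 1)) k, LinearIndependent k L ∧
            (∀ l, (L l).IsHomogeneous 1) ∧
              closure {i.left.base ((CartesianMonoidalCategory.fst X B).left.base z)} =
                ProjectiveSpectrum.zeroLocus (homogeneousSubmodule (Fin (N + 1)) k) (Set.range L) := by
  classical
  let P : SchemeOver k := projectiveSpace N k
  let ι := ιX B X
  let j := (i ▷ B).left
  let e₀ := iK N B X i
  have hP := isPullback_ιX B X
  have hi := range_qgen B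
  -- the line `L = closure {λ'}`, its lift `λX ∈ X_K`, the closed subvariety `V = closure {λX}`
  have ht : N - 1 ≤ N := Nat.sub_le N 1
  let lam : ↥(projectiveSpace N B.left.functionField).left := linearSubspacePoint μ hμli hμhom ht
  have hlamcl : closure {lam} = ProjectiveSpectrum.zeroLocus
      (homogeneousSubmodule (Fin (N + 1)) B.left.functionField) (Set.range μ) :=
    closure_linearSubspacePoint μ hμli hμhom ht
  obtain ⟨lamX, hlamX⟩ : lam ∈ Set.range e₀.base :=
    hline (linearSubspacePoint_mem_zeroLocus μ hμli hμhom ht)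
  let V : ClosedSubvariety (XK B X) := ClosedSubvariety.ofPoint _ lamX
  let e : V.carrier ⟶ (projectiveSpace N B.left.functionField).left := V.ι ≫ e₀
  haveI hecl : IsClosedImmersion e := inferInstanceAs (IsClosedImmersion (V.ι ≫ iK N B X i))
  -- the same instance at the syntactic type `V ⟶ Proj K[x]` used by `RationalPointsOnLinearSubspace`
  haveI : @IsClosedImmersion _ (Proj (homogeneousSubmodule (Fin (N + 1)) B.left.functionField)) e :=
    hecl
  have hVrange : Set.range e.base = ProjectiveSpectrum.zeroLocus
      (homogeneousSubmodule (Fin (N + 1)) B.left.functionField) (Set.range μ) := by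
    rw [← hlamcl, Scheme.Hom.comp_base, TopCat.coe_comp, Set.range_comp,
      ClosedSubvariety.range_ofPoint_ι, ← e₀.isClosedEmbedding.closure_image_eq, Set.image_singleton,
      hlamX]
  obtain ⟨u', hu'⟩ : u ∈ Set.range e.base := by rw [hVrange]; exact hu
  obtain ⟨v', hv'⟩ : v ∈ Set.range e.base := by rw [hVrange]; exact hv
  -- instances on `V` and on `X ×ₖ B`
  haveI : LocallyOfFiniteType (e ≫ (projectiveSpace N B.left.functionField).hom) := inferInstance
  haveI : IsLocallyNoetherian V.carrier :=
    LocallyOfFiniteType.isLocallyNoetherian (e ≫ (projectiveSpace N B.left.functionField).hom)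
  haveI : LocallyOfFiniteType X.hom := by
    have h : i.left ≫ P.hom = X.hom := Over.w i
    rw [← h]
    infer_instance
  haveI : LocallyOfFiniteType (X ⊗ B).hom :=
    inferInstanceAs (LocallyOfFiniteType (pullback.fst X.hom B.hom ≫ X.hom))
  haveI : IsLocallyNoetherian (X ⊗ B).left := LocallyOfFiniteType.isLocallyNoetherian (X ⊗ B).hom
  -- the relation `[u'] - [v'] = [div g]` on the line
  have hu'0 : height u' = 0 := by rw [← height_base_eq_of_isClosedImmersion' e u', hu', hu0]
  have hv'0 : height v' = 0 := by rw [← height_base_eq_of_isClosedImmersion' e v', hv', hv0]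
  obtain ⟨g, hg0, hg⟩ := exists_eq_ord_sub_primeCycle_of_range_eq_line (k := B.left.functionField)
    hN μ hμli hμhom e hVrange hu'0 hv'0 (by rw [← hu', ← hv'] at hdeg; exact hdeg)
  -- spread to `X ×ₖ B` (Bloch, Lemma 1A.1): the closure `S = V̄` and the lift `ḡ`
  haveI := flat_toImage hP V
  haveI := isPreimmersion_toImage hP V
  haveI : IsLocallyNoetherian (V.image ι).carrier := LocallyOfFiniteType.isLocallyNoetherian (V.image ι).ι
  obtain ⟨gbar, hgbar⟩ := (functionFieldMap_bijective_of_flat_of_isPreimmersion (V.toImage ι)).2 g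
  have hgbar0 : gbar ≠ 0 := by
    rintro rfl
    exact hg0 (by rw [← hgbar, map_zero])
  have hVdim : V.dim = (0 : ℕ) + 1 := by
    change height V.genericPoint = _
    rw [ClosedSubvariety.genericPoint_ofPoint, ← height_base_eq_of_isClosedImmersion' e₀ lamX, hlamX,
      height_linearSubspacePoint, show N - (N - 1) = 1 by omega]
    rfl
  have hdim : (V.image ι).dim = ↑(0 + 1) + 1 := by
    rw [dim_image_eq hP hi hB1 V, hVdim]
    push_cast
    ring
  let c' : AlgebraicCycle (X ⊗ B).left ℤ :=
    (V.image ι).div (ClosedSubvariety.locallyFiniteSupport_divFun_holds _) gbar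
  have hc'gen : c' ∈ ratEquivGenerators (X ⊗ B).left 1 :=
    ⟨divFun_mem_cyclesOfDim_holds (X ⊗ B) (V.image ι) hdim hgbar0 _ rfl, V.image ι, inferInstance,
      gbar, hgbar0, hdim, rfl⟩
  have hc'rat : c' ∈ ratTrivial (X ⊗ B).left 1 := AddSubgroup.subset_closure hc'gen
  have hc'dim : c' ∈ cyclesOfDim (X ⊗ B).left 1 := hc'gen.1
  -- `c' ∘ ι = [u_X] - [v_X]` with `u_X = V.ι u'`, `v_X = V.ι v'`
  have hVι_inj : Function.Injective V.ι.base := V.ι_base_injective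
  haveI : IsPreimmersion ι := MorphismProperty.of_isPullback hP.flip inferInstance
  have hι_inj : Function.Injective ι.base := ι.isEmbedding.injective
  have hkey : ∀ x, c' (ι.base x) = (primeCycle (V.ι.base u') - primeCycle (V.ι.base v')) x := by
    intro x
    change (V.image ι).divFun gbar (ι.base x) = _
    rw [divFun_image_ι_apply hP V gbar x, hgbar]
    by_cases hx : x ∈ Set.range V.ι.base
    · obtain ⟨y, rfl⟩ := hx
      rw [ClosedSubvariety.divFun_ι_base, ← hg y]
      simp only [Function.locallyFinsuppWithin.coe_sub, Pi.sub_apply]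
      rw [primeCycle_apply_of_injective' hVι_inj, primeCycle_apply_of_injective' hVι_inj]
    · rw [ClosedSubvariety.divFun_of_notMem_range _ _ hx, Function.locallyFinsuppWithin.coe_sub,
        Pi.sub_apply]
      have hxu : x ≠ V.ι.base u' := fun h => hx (h ▸ ⟨u', rfl⟩)
      have hxv : x ≠ V.ι.base v' := fun h => hx (h ▸ ⟨v', rfl⟩)
      rw [primeCycle_apply_of_ne hxu, primeCycle_apply_of_ne hxv, sub_zero]
  -- the vertical part
  refine ⟨c', hc'rat, V.ι.base u', V.ι.base v', hu', hv',
    c' - primeCycle (ι.base (V.ι.base u')) + primeCycle (ι.base (V.ι.base v')), by abel, ?_⟩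
  intro z hz
  have hsndι : ∀ x, (CartesianMonoidalCategory.snd X B).left.base (ι.base x) = genericPoint B.left := by
    intro x
    have hx : ι.base x ∈ Set.range (ιX B X).base := ⟨x, rfl⟩
    rw [range_ιX] at hx
    exact hx
  -- `z` is not over the generic point
  have hzη : (CartesianMonoidalCategory.snd X B).left.base z ≠ genericPoint B.left := by
    intro hη
    obtain ⟨x, rfl⟩ : z ∈ Set.range ι.base := by
      rw [show ι = ιX B X from rfl, range_ιX]; exact hη
    apply hz
    simp only [Function.locallyFinsuppWithin.coe_add, Function.locallyFinsuppWithin.coe_sub,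
      Pi.add_apply, Pi.sub_apply, hkey x, primeCycle_apply_of_injective' hι_inj]
    ring
  have hzu : primeCycle (ι.base (V.ι.base u')) z = 0 :=
    primeCycle_apply_of_ne fun h => hzη (by rw [h]; exact hsndι _)
  have hzv : primeCycle (ι.base (V.ι.base v')) z = 0 :=
    primeCycle_apply_of_ne fun h => hzη (by rw [h]; exact hsndι _)
  have hcz : c' z ≠ 0 := by
    have hcz' : (c' - primeCycle (ι.base (V.ι.base u')) + primeCycle (ι.base (V.ι.base v'))) z =
        c' z := by
      simp only [Function.locallyFinsuppWithin.coe_add, Function.locallyFinsuppWithin.coe_sub,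
        Pi.add_apply, Pi.sub_apply, hzu, hzv]
      ring
    rwa [hcz'] at hz
  have hheight : height z = 1 := hc'dim z hcz
  -- `pr₂ z` is a closed point
  have hclosed : IsClosed ({(CartesianMonoidalCategory.snd X B).left.base z} : Set B.left) :=
    isClosed_singleton_of_ne_genericPoint hB1 hzη
  -- `z` lies in the closure of `ι λX`, so `w = (i × B) z` lies in the closure of `ι_ℙ λ'`
  have hzS : z ∈ closure {ι.base lamX} := by
    have hzr : z ∈ Set.range (V.image ι).ι.base := by
      by_contra hnot
      exact hcz (ClosedSubvariety.divFun_of_notMem_range _ _ hnot)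
    rw [ClosedSubvariety.range_ι_eq_closure, ClosedSubvariety.genericPoint_image,
      ClosedSubvariety.genericPoint_ofPoint] at hzr
    exact hzr
  have hjι : ∀ x, j.base (ι.base x) = (genericFibreι N B).base (e₀.base x) := by
    intro x
    change ((ιX B X ≫ (i ▷ B).left).base x) = ((iK N B X i ≫ genericFibreι N B).base x)
    rw [iK_genericFibreι]
  have hwS : j.base z ∈ closure {(genericFibreι N B).base lam} := by
    have h := image_closure_subset_closure_image j.base.hom.continuous
      (s := {ι.base lamX}) ⟨z, hzS, rfl⟩
    rw [Set.image_singleton, hjι, hlamX] at h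
    exact h
  have hwheight : height (j.base z) = 1 := by
    rw [height_base_eq_of_isClosedImmersion' j z, hheight]
  have hwsnd : (CartesianMonoidalCategory.snd P B).left.base (j.base z) =
      (CartesianMonoidalCategory.snd X B).left.base z := by
    change (((i ▷ B).left ≫ (CartesianMonoidalCategory.snd P B).left).base z) = _
    rw [whiskerRight_left_snd]
  have hwfst : (CartesianMonoidalCategory.fst P B).left.base (j.base z) =
      i.left.base ((CartesianMonoidalCategory.fst X B).left.base z) := by
    change (((i ▷ B).left ≫ (CartesianMonoidalCategory.fst P B).left).base z) = _
    rw [whiskerRight_left_fst]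
    rfl
  -- limits of lines are lines
  obtain ⟨L, hLli, hLhom, hcl⟩ := exists_line_of_vertical hN B (genericFibreι N B)
    (genericFibreι_fst N B) (genericFibreι_snd N B) μ hμli hμhom lam
    (fun l => linearSubspacePoint_mem_zeroLocus μ hμli hμhom ht ⟨l, rfl⟩)
    hwS hwheight hclosed hwsnd (hpid _ hclosed)
  refine ⟨hheight, hclosed, L, hLli, hLhom, ?_⟩
  rw [← hwfst]
  exact hcl

end Relation

end ProjFamily

end Literature.AlgebraicGeometry.Motives

end
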